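import Mathlib
import Literature.Barriers.ValiantsHypothesis.AlgebraicNaturalProofs
import Literature.Computability.AlgebraicComplexity.ArithCircuitProofs
import Literature.Computability.AlgebraicComplexity.IMMInVPProofs

/-!
# Route BarrierLever — item `PartitionMinorsHitByVP` (stmt-ValiantsHypothesis-19717):
# BLOCK PRODUCTS of certified layouts are certified (Kronecker products)

Helper file (`--supports stmt-ValiantsHypothesis-19717`; cell valiant-natproofs, rung V4, 𝒟-side,
prover seat val-np-p6 gen 2). Definition-free, imports no route file. Closes NO item.

Split the row coordinates by a block `B ⊆ Fin h` and the column coordinates by a block `C ⊆ Fin h`.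
A layout indexed by `κ₁ × κ₂` FACTORS if its rows are `u (i₁,i₂) = u₁ i₁ ∪ u₂ i₂` with
`u₁ i₁ ⊆ B`, `u₂ i₂ ⊆ Bᶜ` and its columns are `w (j₁,j₂) = w₁ j₁ ∪ w₂ j₂` with `w₁ j₁ ⊆ C`,
`w₂ j₂ ⊆ Cᶜ` (the two factor layouts `(u₁, w₁)` and `(u₂, w₂)` are square: both indexed by `κ₁`,
resp. `κ₂`). If `f₁` uses only the variables `x_a (a ∈ B)`, `y_c (c ∈ C)` and certifies
`(u₁, w₁)`, and `f₂` uses only `x_a (a ∉ B)`, `y_c (c ∉ C)` and certifies `(u₂, w₂)`, then the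
layout matrix of `f₁ · f₂` on `(u, w)` is the KRONECKER PRODUCT of the two factor matrices, hence
nonsingular (`Matrix.det_kronecker`); the cost is `L(f₁) + L(f₂) + 1` and the degrees add.
So the class of layouts certified inside `SmallCircuits` is closed under block products — the
hit-class analogue of the product structure `M_{f₁f₂} = M_{f₁} ⊗ M_{f₂}` of Nisan's partition
matrix for variable-disjoint products.

* `coeff_mul_of_disjoint_vars` — for `f₁` supported on monomials inside a variable set `V` and `f₂`
  on monomials avoiding `V`: `coeff (m₁ + m₂) (f₁ f₂) = coeff m₁ f₁ · coeff m₂ f₂`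
  (`supp m₁ ⊆ V`, `supp m₂ ∩ V = ∅`).
* `partitionExpo_union` — the exponent of `x^{U₁ ∪ U₂} y^{W₁ ∪ W₂}` is the sum of the exponents of
  the disjoint pieces.
* **`partitionMinor_hit_of_blockProduct`** — the door (`κ₁ × κ₂`-indexed form).
* **`partitionMinor_hit_of_blockProduct_fin`** — the same for `u w : Fin r → Finset (Fin h)` with
  row and column bijections `er, ec : Fin r ≃ κ₁ × κ₂` exhibiting the factorisation.

WHAT THIS IS NOT: a closure property of the certified class; nothing on which layouts are
certified (the content of item 19717), on TT / 19616, on crux 14610 or on VP vs VNP.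
-/

set_option linter.dupNamespace false

namespace Summit.ValiantsHypothesis.ValiantsHypothesis.Theorems.BarrierLever.BlockProduct

open Finset
open scoped Kronecker
open Literature.Barriers.ValiantsHypothesis Literature.Computability.AlgebraicComplexity

variable {n : ℕ}

/-! ## 1. Coefficients of variable-disjoint products -/

/-- **Variable-disjoint products.** If every monomial of `f₁` is supported inside `V` and every
monomial of `f₂` avoids `V`, then for exponents `m₁` supported inside `V` and `m₂` avoiding `V`:
`coeff (m₁ + m₂) (f₁ * f₂) = coeff m₁ f₁ * coeff m₂ f₂`. -/
theorem coeff_mul_of_disjoint_vars (V : Finset (Fin n)) (f₁ f₂ : MvPolynomial (Fin n) ℂ)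
    (hf₁ : ∀ d ∈ f₁.support, d.support ⊆ V) (hf₂ : ∀ d ∈ f₂.support, Disjoint d.support V)
    (m₁ m₂ : Fin n →₀ ℕ) (hm₁ : m₁.support ⊆ V) (hm₂ : Disjoint m₂.support V) :
    MvPolynomial.coeff (m₁ + m₂) (f₁ * f₂) = MvPolynomial.coeff m₁ f₁ * MvPolynomial.coeff m₂ f₂ := by
  classical
  rw [MvPolynomial.coeff_mul]
  rw [Finset.sum_eq_single (m₁, m₂)]
  · rintro ⟨d₁, d₂⟩ hd hne
    replace hd : d₁ + d₂ = m₁ + m₂ := by simpa using hd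
    by_cases h₁ : d₁ ∈ f₁.support
    · by_cases h₂ : d₂ ∈ f₂.support
      · exfalso
        apply hne
        have hV₁ := hf₁ d₁ h₁
        have hV₂ := hf₂ d₂ h₂
        have key : d₁ = m₁ := by
          ext v
          have hv := congrArg (fun e : (Fin n →₀ ℕ) => e v) hd
          simp only [Finsupp.coe_add, Pi.add_apply] at hv
          by_cases hvV : v ∈ V
          · have hd₂ : d₂ v = 0 := by
              by_contra hne'
              exact (Finset.disjoint_left.mp hV₂ (Finsupp.mem_support_iff.mpr hne')) hvV
            have hm₂' : m₂ v = 0 := by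
              by_contra hne'
              exact (Finset.disjoint_left.mp hm₂ (Finsupp.mem_support_iff.mpr hne')) hvV
            omega
          · have hd₁ : d₁ v = 0 := by
              by_contra hne'
              exact hvV (hV₁ (Finsupp.mem_support_iff.mpr hne'))
            have hm₁' : m₁ v = 0 := by
              by_contra hne'
              exact hvV (hm₁ (Finsupp.mem_support_iff.mpr hne'))
            omega
        subst key
        have key₂ : d₂ = m₂ := add_left_cancel hd
        subst key₂
        rfl
      · rw [MvPolynomial.notMem_support_iff.mp h₂, mul_zero]
    · rw [MvPolynomial.notMem_support_iff.mp h₁, zero_mul]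
  · intro hh
    exact absurd (by simp) hh

/-! ## 2. The exponent of a block-product monomial -/

/-- The partition exponent of `x^{U₁ ∪ U₂} y^{W₁ ∪ W₂}` for disjoint `U₁, U₂` and disjoint `W₁, W₂`
is the sum of the two partition exponents. -/
theorem partitionExpo_union {h : ℕ} (U₁ U₂ W₁ W₂ : Finset (Fin h)) (hU : Disjoint U₁ U₂)
    (hW : Disjoint W₁ W₂) :
    (∑ a ∈ U₁ ∪ U₂, Finsupp.single (Fin.castAdd h a) 1 +
        ∑ c ∈ W₁ ∪ W₂, Finsupp.single (Fin.natAdd h c) 1 : Fin (h + h) →₀ ℕ) =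
      (∑ a ∈ U₁, Finsupp.single (Fin.castAdd h a) 1 + ∑ c ∈ W₁, Finsupp.single (Fin.natAdd h c) 1) +
      (∑ a ∈ U₂, Finsupp.single (Fin.castAdd h a) 1 + ∑ c ∈ W₂, Finsupp.single (Fin.natAdd h c) 1) := by
  rw [Finset.sum_union hU, Finset.sum_union hW]
  abel

/-- The support of the partition exponent of `x^U y^W` consists of the variables `x_a, a ∈ U` and
`y_c, c ∈ W`. -/
theorem support_partitionExpo_subset {h : ℕ} (U W : Finset (Fin h)) :
    (∑ a ∈ U, Finsupp.single (Fin.castAdd h a) 1 +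
        ∑ c ∈ W, Finsupp.single (Fin.natAdd h c) 1 : Fin (h + h) →₀ ℕ).support ⊆
      U.map (Fin.castAddEmb h) ∪ W.map (Fin.natAddEmb h) := by
  classical
  intro v hv
  rw [Finsupp.mem_support_iff] at hv
  simp only [Finsupp.coe_add, Pi.add_apply, Finsupp.coe_finsetSum, Finset.sum_apply,
    Finsupp.single_apply] at hv
  rw [Finset.mem_union, Finset.mem_map, Finset.mem_map]
  by_contra hcon
  simp only [not_or, not_exists, not_and, Fin.castAddEmb_apply, Fin.natAddEmb_apply] at hcon
  apply hv
  rw [Finset.sum_eq_zero (fun a ha => if_neg (fun hh => hcon.1 a ha hh)),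
    Finset.sum_eq_zero (fun c hc => if_neg (fun hh => hcon.2 c hc hh)), add_zero]

/-- Block variable sets are complementary: the variables of `(B, C)` and those of `(Bᶜ, Cᶜ)` are
disjoint. -/
theorem disjoint_blockVars {h : ℕ} (B C : Finset (Fin h)) :
    Disjoint (Bᶜ.map (Fin.castAddEmb h) ∪ Cᶜ.map (Fin.natAddEmb h))
      (B.map (Fin.castAddEmb h) ∪ C.map (Fin.natAddEmb h)) := by
  classical
  rw [Finset.disjoint_left]
  intro v hv hv'
  rw [Finset.mem_union, Finset.mem_map, Finset.mem_map] at hv hv'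
  rcases hv with ⟨a, ha, rfl⟩ | ⟨c, hc, rfl⟩
  · rcases hv' with ⟨a', ha', hh⟩ | ⟨c', _, hh⟩
    · have : a' = a := by
        have := congrArg Fin.val hh; simp [Fin.castAddEmb] at this; exact Fin.ext this
      subst this
      exact (Finset.mem_compl.mp ha) ha'
    · have := congrArg Fin.val hh
      simp [Fin.castAddEmb, Fin.natAddEmb] at this
      omega
  · rcases hv' with ⟨a', _, hh⟩ | ⟨c', hc', hh⟩
    · have := congrArg Fin.val hh
      simp [Fin.castAddEmb, Fin.natAddEmb] at this
      omega
    · have : c' = c := by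
        have := congrArg Fin.val hh; simp [Fin.natAddEmb] at this; exact Fin.ext this
      subst this
      exact (Finset.mem_compl.mp hc) hc'

/-! ## 3. The block-product door -/

/-- **Block products of certified layouts are certified.** Row block `B`, column block `C`;
factor layouts `(u₁, w₁)` (inside `B`, `C`) indexed by `κ₁` and `(u₂, w₂)` (inside `Bᶜ`, `Cᶜ`)
indexed by `κ₂`; `f₁` supported on the variables of `(B, C)`, `f₂` on those of `(Bᶜ, Cᶜ)`; both
factor matrices nonsingular ⇒ the layout matrix of `f₁ f₂` on the product layout
`u (i₁,i₂) = u₁ i₁ ∪ u₂ i₂`, `w (j₁,j₂) = w₁ j₁ ∪ w₂ j₂` is nonsingular, with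
`L(f₁ f₂) ≤ L f₁ + L f₂ + 1` and `deg (f₁ f₂) ≤ deg f₁ + deg f₂`. -/
theorem partitionMinor_hit_of_blockProduct {h : ℕ} {κ₁ κ₂ : Type*} [Fintype κ₁] [Fintype κ₂]
    [DecidableEq κ₁] [DecidableEq κ₂] (B C : Finset (Fin h))
    (u₁ w₁ : κ₁ → Finset (Fin h)) (u₂ w₂ : κ₂ → Finset (Fin h))
    (hu₁ : ∀ i, u₁ i ⊆ B) (hw₁ : ∀ j, w₁ j ⊆ C) (hu₂ : ∀ i, u₂ i ⊆ Bᶜ) (hw₂ : ∀ j, w₂ j ⊆ Cᶜ)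
    (f₁ f₂ : MvPolynomial (Fin (h + h)) ℂ)
    (hf₁ : ∀ d ∈ f₁.support, d.support ⊆ B.map (Fin.castAddEmb h) ∪ C.map (Fin.natAddEmb h))
    (hf₂ : ∀ d ∈ f₂.support, d.support ⊆ Bᶜ.map (Fin.castAddEmb h) ∪ Cᶜ.map (Fin.natAddEmb h))
    (hdet₁ : (Matrix.of fun i j : κ₁ => MvPolynomial.coeff
        (∑ a ∈ u₁ i, Finsupp.single (Fin.castAdd h a) 1 +
          ∑ c ∈ w₁ j, Finsupp.single (Fin.natAdd h c) 1) f₁).det ≠ 0)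
    (hdet₂ : (Matrix.of fun i j : κ₂ => MvPolynomial.coeff
        (∑ a ∈ u₂ i, Finsupp.single (Fin.castAdd h a) 1 +
          ∑ c ∈ w₂ j, Finsupp.single (Fin.natAdd h c) 1) f₂).det ≠ 0) :
    complexity (f₁ * f₂) ≤ complexity f₁ + complexity f₂ + 1 ∧
    (f₁ * f₂).totalDegree ≤ f₁.totalDegree + f₂.totalDegree ∧
    (Matrix.of fun i j : κ₁ × κ₂ => MvPolynomial.coeff
        (∑ a ∈ u₁ i.1 ∪ u₂ i.2, Finsupp.single (Fin.castAdd h a) 1 +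
          ∑ c ∈ w₁ j.1 ∪ w₂ j.2, Finsupp.single (Fin.natAdd h c) 1) (f₁ * f₂)).det ≠ 0 := by
  classical
  refine ⟨complexity_mul_le_holds _ _, MvPolynomial.totalDegree_mul _ _, ?_⟩
  set M₁ : Matrix κ₁ κ₁ ℂ := Matrix.of fun i j : κ₁ => MvPolynomial.coeff
    (∑ a ∈ u₁ i, Finsupp.single (Fin.castAdd h a) 1 + ∑ c ∈ w₁ j, Finsupp.single (Fin.natAdd h c) 1) f₁
    with hM₁
  set M₂ : Matrix κ₂ κ₂ ℂ := Matrix.of fun i j : κ₂ => MvPolynomial.coeff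
    (∑ a ∈ u₂ i, Finsupp.single (Fin.castAdd h a) 1 + ∑ c ∈ w₂ j, Finsupp.single (Fin.natAdd h c) 1) f₂
    with hM₂
  have hK : (Matrix.of fun i j : κ₁ × κ₂ => MvPolynomial.coeff
      (∑ a ∈ u₁ i.1 ∪ u₂ i.2, Finsupp.single (Fin.castAdd h a) 1 +
        ∑ c ∈ w₁ j.1 ∪ w₂ j.2, Finsupp.single (Fin.natAdd h c) 1) (f₁ * f₂)) = M₁ ⊗ₖ M₂ := by
    ext ⟨i₁, i₂⟩ ⟨j₁, j₂⟩
    rw [Matrix.of_apply, Matrix.kronecker_apply, hM₁, hM₂, Matrix.of_apply, Matrix.of_apply]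
    have hU : Disjoint (u₁ i₁) (u₂ i₂) :=
      Finset.disjoint_of_subset_left (hu₁ i₁)
        (Finset.disjoint_of_subset_right (hu₂ i₂) disjoint_compl_right)
    have hW : Disjoint (w₁ j₁) (w₂ j₂) :=
      Finset.disjoint_of_subset_left (hw₁ j₁)
        (Finset.disjoint_of_subset_right (hw₂ j₂) disjoint_compl_right)
    rw [partitionExpo_union _ _ _ _ hU hW]
    refine coeff_mul_of_disjoint_vars (B.map (Fin.castAddEmb h) ∪ C.map (Fin.natAddEmb h)) f₁ f₂
      hf₁ (fun d hd => Finset.disjoint_of_subset_left (hf₂ d hd) (disjoint_blockVars B C)) _ _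
      ((support_partitionExpo_subset _ _).trans (Finset.union_subset_union
        (Finset.map_subset_map.mpr (hu₁ i₁)) (Finset.map_subset_map.mpr (hw₁ j₁)))) ?_
    exact Finset.disjoint_of_subset_left ((support_partitionExpo_subset _ _).trans
      (Finset.union_subset_union (Finset.map_subset_map.mpr (hu₂ i₂))
        (Finset.map_subset_map.mpr (hw₂ j₂)))) (disjoint_blockVars B C)
  rw [hK, Matrix.det_kronecker]
  exact mul_ne_zero (pow_ne_zero _ hdet₁) (pow_ne_zero _ hdet₂)

/-- **Block-product door, `Fin r` form.** A layout `u w : Fin r → Finset (Fin h)` that factors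
along the row block `B` and the column block `C` through bijections `er, ec : Fin r ≃ κ₁ × κ₂`
(`u i = u₁ (er i).1 ∪ u₂ (er i).2`, `w j = w₁ (ec j).1 ∪ w₂ (ec j).2`) is certified by the product
of the factor witnesses. -/
theorem partitionMinor_hit_of_blockProduct_fin {h r : ℕ} {κ₁ κ₂ : Type*} [Fintype κ₁] [Fintype κ₂]
    [DecidableEq κ₁] [DecidableEq κ₂] (B C : Finset (Fin h)) (u w : Fin r → Finset (Fin h))
    (u₁ w₁ : κ₁ → Finset (Fin h)) (u₂ w₂ : κ₂ → Finset (Fin h))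
    (hu₁ : ∀ i, u₁ i ⊆ B) (hw₁ : ∀ j, w₁ j ⊆ C) (hu₂ : ∀ i, u₂ i ⊆ Bᶜ) (hw₂ : ∀ j, w₂ j ⊆ Cᶜ)
    (er ec : Fin r ≃ κ₁ × κ₂) (hu : ∀ i, u i = u₁ (er i).1 ∪ u₂ (er i).2)
    (hw : ∀ j, w j = w₁ (ec j).1 ∪ w₂ (ec j).2)
    (f₁ f₂ : MvPolynomial (Fin (h + h)) ℂ)
    (hf₁ : ∀ d ∈ f₁.support, d.support ⊆ B.map (Fin.castAddEmb h) ∪ C.map (Fin.natAddEmb h))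
    (hf₂ : ∀ d ∈ f₂.support, d.support ⊆ Bᶜ.map (Fin.castAddEmb h) ∪ Cᶜ.map (Fin.natAddEmb h))
    (hdet₁ : (Matrix.of fun i j : κ₁ => MvPolynomial.coeff
        (∑ a ∈ u₁ i, Finsupp.single (Fin.castAdd h a) 1 +
          ∑ c ∈ w₁ j, Finsupp.single (Fin.natAdd h c) 1) f₁).det ≠ 0)
    (hdet₂ : (Matrix.of fun i j : κ₂ => MvPolynomial.coeff
        (∑ a ∈ u₂ i, Finsupp.single (Fin.castAdd h a) 1 +
          ∑ c ∈ w₂ j, Finsupp.single (Fin.natAdd h c) 1) f₂).det ≠ 0) :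
    complexity (f₁ * f₂) ≤ complexity f₁ + complexity f₂ + 1 ∧
    (f₁ * f₂).totalDegree ≤ f₁.totalDegree + f₂.totalDegree ∧
    (Matrix.of fun i j : Fin r => MvPolynomial.coeff
        (∑ a ∈ u i, Finsupp.single (Fin.castAdd h a) 1 +
          ∑ c ∈ w j, Finsupp.single (Fin.natAdd h c) 1) (f₁ * f₂)).det ≠ 0 := by
  classical
  obtain ⟨hsize, hdeg, hne⟩ := partitionMinor_hit_of_blockProduct B C u₁ w₁ u₂ w₂ hu₁ hw₁ hu₂ hw₂
    f₁ f₂ hf₁ hf₂ hdet₁ hdet₂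
  refine ⟨hsize, hdeg, ?_⟩
  set K : Matrix (κ₁ × κ₂) (κ₁ × κ₂) ℂ := Matrix.of fun i j : κ₁ × κ₂ => MvPolynomial.coeff
    (∑ a ∈ u₁ i.1 ∪ u₂ i.2, Finsupp.single (Fin.castAdd h a) 1 +
      ∑ c ∈ w₁ j.1 ∪ w₂ j.2, Finsupp.single (Fin.natAdd h c) 1) (f₁ * f₂) with hKdef
  have hsub : (Matrix.of fun i j : Fin r => MvPolynomial.coeff
      (∑ a ∈ u i, Finsupp.single (Fin.castAdd h a) 1 +
        ∑ c ∈ w j, Finsupp.single (Fin.natAdd h c) 1) (f₁ * f₂)) = K.submatrix er ec := by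
    ext i j
    rw [Matrix.of_apply, Matrix.submatrix_apply, hKdef, Matrix.of_apply, hu i, hw j]
  have hsub' : K.submatrix er ec = (K.submatrix er er).submatrix id (ec.trans er.symm) := by
    ext i j
    simp [Matrix.submatrix_apply]
  rw [hsub, hsub', Matrix.det_permute', Matrix.det_submatrix_equiv_self]
  exact mul_ne_zero (by
    rcases Int.units_eq_one_or (Equiv.Perm.sign (ec.trans er.symm)) with h1 | h1 <;> simp [h1]) hne

end Summit.ValiantsHypothesis.ValiantsHypothesis.Theorems.BarrierLever.BlockProduct
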